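import Summits.HubbardSuperconductivity.HubbardSuperconductivity.Theorems.AnisotropyChordResolventGramTP

/-!
# Route `AnisotropyChord`: the Gram kernel along the ground branch of a rank-one family is a
# Cauchy–Gram kernel (resolvent form of the states; complex Hermitian setting of LEMMA TP₂ of the
# theory seat `hubbard-h0-rotor-theory-1`, cycle 6 — abstract linear algebra, no lattice)

Setting (as in `…SpinMonotoneResolventBranch`; all vectors in `ι → ℂ`, `ι` finite): `L ⪰ 0` with a
unit kernel vector `e` (`L e = 0`), a vector `s` with `⟨e, s⟩ ≠ 0`, an `L`-invariant subspace
`𝓜 ∋ e, s`.  A STATE ON THE BRANCH at coupling `σ > 0` and level `ε` is a unit vector `ψ ∈ 𝓜` with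

  `L ψ + σ ⟨s, ψ⟩ s = ε ψ`,  `⟨s, ψ⟩ ≠ 0`,

the VARIATIONAL property of `ε` on `𝓜 ∩ s^⊥` (`ε‖f‖² ≤ ⟨f, L f⟩`) and the UNIQUENESS property of
`ε` there (no nonzero `g` with `L g = ε g`) — the situation of the ground state of `L + σ|s⟩⟨s|`
restricted to `𝓜` (two-magnon sector ground states on an edge-transitive graph, file
`…SpinMonotoneTwoMagnonEdgeTransitive`).

* `rankOne_branch_state` — per-state facts: `0 < ε`; `ε < λ_j` for every eigenvalue `λ_j ≠ 0` of `L`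
  whose eigenvector meets `s`; and the RESOLVENT FORM of the coefficients
  `⟨v_j, ψ⟩ = −σ⟨s,ψ⟩ ⟨v_j, s⟩ / (λ_j − ε)` for EVERY `j` (at `λ_j = ε` both sides vanish — uniqueness).
* `rankOne_branch_dotProduct` — two states on the branch: `⟨ψ, ψ'⟩ = conj(σ⟨s,ψ⟩) σ'⟨s,ψ'⟩ K(ε, ε')`
  with the Cauchy–Gram kernel `K(ε,ε') = Σ_j |⟨v_j,s⟩|² / ((λ_j − ε)(λ_j − ε'))`, and `0 ≤ K(ε, ε')`.
* `rankOne_branch_flat_dotProduct` — `⟨e, ψ⟩ = σ⟨s,ψ⟩⟨e,s⟩ / ε`.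
* `norm_star_dotProduct_le_one` — Cauchy–Schwarz for unit vectors, dot-product form.
The TP₂ minors themselves (`gram_tp2_of_rankOne_branch`, the `σ = 0` column, overlap
monotonicity) are in the companion file `…ResolventGramTPMinors`.

Theory seat memo ROTOR-THEORY-6 §52 (COROLLARY TP-W2, proof sketch), §56 P-2/P-3.  B. Simon, *Trace
Ideals* (2005) §11; S. Karlin, *Total Positivity* (1968) Ch. 3.  No definition is introduced.
-/

set_option linter.dupNamespace false

noncomputable section

namespace Summit.HubbardSuperconductivity.HubbardSuperconductivity.Theorems.AnisotropyChord

open Matrix Complex Finset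
open scoped ComplexOrder InnerProductSpace
open Literature.MathematicalPhysics.QuantumLattice

variable {ι : Type*} [Fintype ι] [DecidableEq ι]

omit [DecidableEq ι] in
/-- **Polarised Parseval in an orthonormal basis, dot-product form**:
`star x ⬝ᵥ y = Σ_j conj(star b_j ⬝ᵥ x) (star b_j ⬝ᵥ y)`. [folklore] -/
theorem star_dotProduct_eq_sum_coord (b : OrthonormalBasis ι ℂ (EuclideanSpace ℂ ι))
    (x y : ι → ℂ) :
    star x ⬝ᵥ y = ∑ j, star (star (b j : ι → ℂ) ⬝ᵥ x) * (star (b j : ι → ℂ) ⬝ᵥ y) := by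
  have h := b.sum_inner_mul_inner (WithLp.toLp 2 x : EuclideanSpace ℂ ι) (WithLp.toLp 2 y)
  rw [EuclideanSpace.inner_eq_star_dotProduct, dotProduct_comm] at h
  rw [← h]
  refine Finset.sum_congr rfl fun j _ => ?_
  rw [star_coe_dotProduct_eq_inner, star_coe_dotProduct_eq_inner, ← inner_conj_symm,
    Complex.star_def]

/-- **A state on the ground branch of a rank-one family** (see the module docstring): `0 < ε`,
`ε < λ_j` whenever `⟨v_j, s⟩ ≠ 0 ≠ λ_j`, and the resolvent form of every eigen-coefficient
`⟨v_j, ψ⟩ = −σ⟨s,ψ⟩⟨v_j,s⟩/(λ_j − ε)` (both sides vanish at `λ_j = ε`).  Variational principle +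
rank-one interlacing by hand, as in `flatOverlap_sq_le_of_rankOne_branch`.  Tasaki (2020) App. A.2–A.3;
Simon, *Trace Ideals* §11. [folklore] -/
theorem rankOne_branch_state {L : Matrix ι ι ℂ} (hL : L.PosSemidef)
    (𝓜 : Submodule ℂ (ι → ℂ)) (h𝓜 : ∀ v ∈ 𝓜, L *ᵥ v ∈ 𝓜)
    {e s ψ : ι → ℂ} (he𝓜 : e ∈ 𝓜) (hs𝓜 : s ∈ 𝓜) (hψ𝓜 : ψ ∈ 𝓜)
    (hLe : L *ᵥ e = 0) (he1 : star e ⬝ᵥ e = 1) (ha0 : star e ⬝ᵥ s ≠ 0)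
    {σ ε : ℝ} (hσ : 0 < σ)
    (h : L *ᵥ ψ + ((σ : ℂ) * (star s ⬝ᵥ ψ)) • s = (ε : ℂ) • ψ) (hψn : star ψ ⬝ᵥ ψ = 1)
    (hb : star s ⬝ᵥ ψ ≠ 0)
    (hvar : ∀ f ∈ 𝓜, star s ⬝ᵥ f = 0 → ε * (star f ⬝ᵥ f).re ≤ (star f ⬝ᵥ (L *ᵥ f)).re)
    (huniq : ∀ g ∈ 𝓜, star s ⬝ᵥ g = 0 → L *ᵥ g = (ε : ℂ) • g → g = 0) :
    0 < ε ∧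
    (∀ j, star (hL.1.eigenvectorBasis j : ι → ℂ) ⬝ᵥ s ≠ 0 → hL.1.eigenvalues j ≠ 0 →
      ε < hL.1.eigenvalues j) ∧
    (∀ j, star (hL.1.eigenvectorBasis j : ι → ℂ) ⬝ᵥ ψ =
      -((σ : ℂ) * (star s ⬝ᵥ ψ)) * (star (hL.1.eigenvectorBasis j : ι → ℂ) ⬝ᵥ s) /
        ((hL.1.eigenvalues j : ℂ) - ε)) := by
  have hH : L.IsHermitian := hL.1
  set v : ι → (ι → ℂ) := fun j => (hH.eigenvectorBasis j : ι → ℂ) with hvdef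
  set lam : ι → ℝ := hH.eigenvalues with hlamdef
  have hLv : ∀ j, L *ᵥ v j = ((lam j : ℝ) : ℂ) • v j := fun j => mulVec_eigenvectorBasis_coe hH j
  have hcoef : ∀ j x, star (v j) ⬝ᵥ (L *ᵥ x) = (lam j : ℂ) * (star (v j) ⬝ᵥ x) :=
    fun j x => eigenvector_dotProduct_mulVec_self hH j x
  set a : ι → ℂ := fun j => star (v j) ⬝ᵥ s with hadef
  -- (E1) coefficient equation
  have E1 : ∀ j, ((lam j : ℂ) - ε) * (star (v j) ⬝ᵥ ψ) = -((σ : ℂ) * (star s ⬝ᵥ ψ)) * a j := by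
    intro j
    have h' := congrArg (fun y => star (v j) ⬝ᵥ y) h
    simp only [dotProduct_add, dotProduct_smul, smul_eq_mul, hcoef] at h'
    rw [hadef]
    linear_combination h'
  -- (E3) `ε = ⟨ψ,Lψ⟩ + σ|b|² > 0`
  have hεpos : 0 < ε := by
    have h' := congrArg (fun y => (star ψ ⬝ᵥ y).re) h
    simp only [dotProduct_add, dotProduct_smul, smul_eq_mul, hψn, mul_one, Complex.add_re,
      Complex.ofReal_re] at h'
    have hss : star ψ ⬝ᵥ s = star (star s ⬝ᵥ ψ) := star_dotProduct ψ s
    rw [hss, show ((σ : ℂ) * (star s ⬝ᵥ ψ) * star (star s ⬝ᵥ ψ)).re = σ * ‖star s ⬝ᵥ ψ‖ ^ 2 by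
      rw [mul_assoc, Complex.re_ofReal_mul, mul_comm (star s ⬝ᵥ ψ), re_star_mul_self_eq_norm_sq]] at h'
    have h1 : 0 ≤ (star ψ ⬝ᵥ (L *ᵥ ψ)).re := (Complex.le_def.1 (hL.dotProduct_mulVec_nonneg ψ)).1
    have h2 : 0 < ‖star s ⬝ᵥ ψ‖ ^ 2 := by positivity
    nlinarith
  -- the orthogonal projection onto `𝓜`
  set Q := projMatrix (𝓜.map ((WithLp.linearEquiv 2 ℂ (ι → ℂ)).symm :
    (ι → ℂ) →ₗ[ℂ] EuclideanSpace ℂ ι)) with hQdef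
  have hQh : Q.IsHermitian := projMatrix_isHermitian _
  have hQadj : ∀ x y : ι → ℂ, star (Q *ᵥ x) ⬝ᵥ y = star x ⬝ᵥ (Q *ᵥ y) := fun x y => by
    rw [star_mulVec, hQh.eq, ← dotProduct_mulVec]
  have hQmem : ∀ x, Q *ᵥ x ∈ 𝓜 := fun x => projMatrix_map_mulVec_mem 𝓜 x
  have hQfix : ∀ x ∈ 𝓜, Q *ᵥ x = x := fun x hx => projMatrix_map_mulVec_of_mem 𝓜 hx
  have hQL : Q * L = L * Q := projMatrix_map_commute_of_invariant hH 𝓜 h𝓜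
  have hLQv : ∀ j, L *ᵥ (Q *ᵥ v j) = ((lam j : ℝ) : ℂ) • (Q *ᵥ v j) := by
    intro j
    rw [mulVec_mulVec, ← hQL, ← mulVec_mulVec, hLv, mulVec_smul]
  have hsQv : ∀ j, star s ⬝ᵥ (Q *ᵥ v j) = star (a j) := by
    intro j
    rw [← hQadj, hQfix s hs𝓜, hadef]
    exact star_dotProduct s (v j)
  have heperp : ∀ j, lam j ≠ 0 → star (v j) ⬝ᵥ e = 0 := by
    intro j hj
    have h := hcoef j e
    rw [hLe, dotProduct_zero] at h
    rcases mul_eq_zero.1 h.symm with h1 | h1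
    · exact absurd (by exact_mod_cast h1 : lam j = 0) hj
    · exact h1
  have heQv : ∀ j, lam j ≠ 0 → star e ⬝ᵥ (Q *ᵥ v j) = 0 := by
    intro j hj
    rw [← hQadj, hQfix e he𝓜, star_dotProduct, heperp j hj, star_zero]
  -- Step A: `λ_j > ε` whenever `a_j ≠ 0 ≠ λ_j`
  have stepA : ∀ j, a j ≠ 0 → lam j ≠ 0 → ε < lam j := by
    intro j haj hlj
    set g := Q *ᵥ v j with hgdef
    have hg𝓜 : g ∈ 𝓜 := hQmem _
    have hgs : star s ⬝ᵥ g = star (a j) := hsQv j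
    have hge : star e ⬝ᵥ g = 0 := heQv j hlj
    have hg0 : g ≠ 0 := by
      intro h0
      rw [h0, dotProduct_zero] at hgs
      exact haj (star_eq_zero.1 hgs.symm)
    have hgpos : 0 < (star g ⬝ᵥ g).re := by
      have h := Matrix.dotProduct_star_self_pos_iff.2 hg0
      have h2 := (Complex.lt_def.1 h).1
      rw [Complex.zero_re] at h2
      exact h2
    set α : ℂ := star s ⬝ᵥ g with hαdef
    set β : ℂ := star s ⬝ᵥ e with hβdef
    set f := α • e - β • g with hfdef
    have hf𝓜 : f ∈ 𝓜 := 𝓜.sub_mem (𝓜.smul_mem _ he𝓜) (𝓜.smul_mem _ hg𝓜)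
    have hfs : star s ⬝ᵥ f = 0 := by
      rw [hfdef, dotProduct_sub, dotProduct_smul, dotProduct_smul, smul_eq_mul, smul_eq_mul,
        ← hαdef, ← hβdef]
      ring
    have hge' : star g ⬝ᵥ e = 0 := by
      rw [star_dotProduct g e, hge, star_zero]
    have hLf : L *ᵥ f = -(β * (lam j : ℂ)) • g := by
      rw [hfdef, mulVec_sub, mulVec_smul, mulVec_smul, hLe, smul_zero, zero_sub, hgdef, hLQv j,
        smul_smul, neg_smul]
    have hff_c : star f ⬝ᵥ f = star α * α + star β * β * (star g ⬝ᵥ g) := by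
      rw [hfdef]
      simp only [star_sub, star_smul, sub_dotProduct, smul_dotProduct, dotProduct_sub,
        dotProduct_smul, smul_eq_mul, he1, hge, hge']
      ring
    have hfLf_c : star f ⬝ᵥ (L *ᵥ f) = star β * β * (lam j : ℂ) * (star g ⬝ᵥ g) := by
      rw [hLf, dotProduct_smul, smul_eq_mul, hfdef]
      simp only [star_sub, star_smul, sub_dotProduct, smul_dotProduct, smul_eq_mul, hge]
      ring
    have hreβ : ∀ X : ℂ, (star β * β * X).re = ‖β‖ ^ 2 * X.re := by
      intro X
      rw [Complex.star_def, Complex.conj_mul', ← Complex.ofReal_pow, Complex.re_ofReal_mul]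
    have hff : (star f ⬝ᵥ f).re = ‖α‖ ^ 2 + ‖β‖ ^ 2 * (star g ⬝ᵥ g).re := by
      rw [hff_c, Complex.add_re, re_star_mul_self_eq_norm_sq, hreβ]
    have hfLf : (star f ⬝ᵥ (L *ᵥ f)).re = ‖β‖ ^ 2 * (lam j * (star g ⬝ᵥ g).re) := by
      rw [hfLf_c, mul_assoc, hreβ, Complex.re_ofReal_mul]
    have hαpos : 0 < ‖α‖ ^ 2 := by
      have : α ≠ 0 := by rw [hgs]; exact star_ne_zero.2 haj
      positivity
    have hβpos : 0 < ‖β‖ ^ 2 := by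
      have : β ≠ 0 := by
        rw [hβdef, star_dotProduct s e]
        exact star_ne_zero.2 ha0
      positivity
    have hv := hvar f hf𝓜 hfs
    rw [hff, hfLf] at hv
    by_contra hle
    push Not at hle
    have h1 : ‖β‖ ^ 2 * (lam j * (star g ⬝ᵥ g).re) ≤ ‖β‖ ^ 2 * (ε * (star g ⬝ᵥ g).re) :=
      mul_le_mul_of_nonneg_left (mul_le_mul_of_nonneg_right hle hgpos.le) hβpos.le
    nlinarith [mul_pos hεpos hαpos, mul_nonneg hβpos.le (mul_nonneg hεpos.le hgpos.le)]
  -- Step B: no component on `ker(L − ε)`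
  have stepB : ∀ j, lam j = ε → star (v j) ⬝ᵥ ψ = 0 := by
    intro j hj
    have haj : a j = 0 := by
      have h := E1 j
      rw [hj, sub_self, zero_mul] at h
      have hσb : (σ : ℂ) * (star s ⬝ᵥ ψ) ≠ 0 := mul_ne_zero (by exact_mod_cast hσ.ne') hb
      rcases mul_eq_zero.1 h.symm with h1 | h1
      · exact absurd (neg_eq_zero.1 h1) hσb
      · exact h1
    have hg0 : Q *ᵥ v j = 0 :=
      huniq _ (hQmem _) (by rw [hsQv j, haj, star_zero]) (by rw [hLQv j, hj])
    calc star (v j) ⬝ᵥ ψ = star (v j) ⬝ᵥ (Q *ᵥ ψ) := by rw [hQfix ψ hψ𝓜]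
      _ = star (Q *ᵥ v j) ⬝ᵥ ψ := (hQadj _ _).symm
      _ = 0 := by rw [hg0, star_zero, zero_dotProduct]
  refine ⟨hεpos, fun j haj hlj => stepA j haj hlj, fun j => ?_⟩
  by_cases hj : lam j = ε
  · rw [stepB j hj]
    have : ((lam j : ℂ) - ε) = 0 := by rw [hj, sub_self]
    rw [show ((hH.eigenvalues j : ℝ) : ℂ) - (ε : ℂ) = 0 from this, div_zero]
  · have hne : ((lam j : ℂ) - ε) ≠ 0 := by
      intro h0
      exact hj (by exact_mod_cast sub_eq_zero.1 h0)
    rw [eq_div_iff hne, mul_comm]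
    exact E1 j

omit [DecidableEq ι] in
/-- **Kernel-vector pairing on the branch**: `ε ⟨e, ψ⟩ = σ⟨s,ψ⟩⟨e,s⟩`, i.e.
`⟨e, ψ⟩ = σ⟨s,ψ⟩⟨e,s⟩/ε` for `ε ≠ 0`. [folklore] -/
theorem rankOne_branch_flat_dotProduct {L : Matrix ι ι ℂ} (hH : L.IsHermitian)
    {e s ψ : ι → ℂ} (hLe : L *ᵥ e = 0) {σ ε : ℝ} (hε : ε ≠ 0)
    (h : L *ᵥ ψ + ((σ : ℂ) * (star s ⬝ᵥ ψ)) • s = (ε : ℂ) • ψ) :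
    star e ⬝ᵥ ψ = (σ : ℂ) * (star s ⬝ᵥ ψ) * (star e ⬝ᵥ s) / ε := by
  have h' := congrArg (fun y => star e ⬝ᵥ y) h
  simp only [dotProduct_add, dotProduct_smul, smul_eq_mul,
    star_dotProduct_mulVec_eq_zero_of_kernel hH hLe, zero_add] at h'
  have hε' : (ε : ℂ) ≠ 0 := by exact_mod_cast hε
  rw [eq_div_iff hε', mul_comm]
  exact h'.symm

/-- **Two states on the branch: the Gram entry is a Cauchy–Gram kernel value.**  With
`c = σ⟨s,ψ⟩`, `c' = σ'⟨s,ψ'⟩` and the resolvent form of the coefficients,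
`⟨ψ, ψ'⟩ = conj(c) c' Σ_j |⟨v_j,s⟩|²/((λ_j − ε)(λ_j − ε'))`. [folklore] -/
theorem rankOne_branch_dotProduct {L : Matrix ι ι ℂ} (hH : L.IsHermitian) {s ψ ψ' : ι → ℂ}
    {c c' : ℂ} {ε ε' : ℝ}
    (hψ : ∀ j, star (hH.eigenvectorBasis j : ι → ℂ) ⬝ᵥ ψ =
      -c * (star (hH.eigenvectorBasis j : ι → ℂ) ⬝ᵥ s) / ((hH.eigenvalues j : ℂ) - ε))
    (hψ' : ∀ j, star (hH.eigenvectorBasis j : ι → ℂ) ⬝ᵥ ψ' =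
      -c' * (star (hH.eigenvectorBasis j : ι → ℂ) ⬝ᵥ s) / ((hH.eigenvalues j : ℂ) - ε')) :
    star ψ ⬝ᵥ ψ' = star c * c' *
      ((∑ j, ‖star (hH.eigenvectorBasis j : ι → ℂ) ⬝ᵥ s‖ ^ 2 /
        ((hH.eigenvalues j - ε) * (hH.eigenvalues j - ε')) : ℝ) : ℂ) := by
  rw [star_dotProduct_eq_sum_coord hH.eigenvectorBasis ψ ψ', Complex.ofReal_sum, Finset.mul_sum]
  refine Finset.sum_congr rfl fun j _ => ?_
  rw [hψ j, hψ' j]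
  set a : ℂ := star (hH.eigenvectorBasis j : ι → ℂ) ⬝ᵥ s with hadef
  have hnorm : ((‖a‖ ^ 2 : ℝ) : ℂ) = star a * a := by
    rw [Complex.star_def, Complex.conj_mul', Complex.ofReal_pow]
  have hl : star ((hH.eigenvalues j : ℂ) - (ε : ℂ)) = (hH.eigenvalues j : ℂ) - (ε : ℂ) := by
    rw [← Complex.ofReal_sub, Complex.star_def, Complex.conj_ofReal]
  rw [Complex.ofReal_div, Complex.ofReal_mul, Complex.ofReal_sub, Complex.ofReal_sub, hnorm,
    star_div₀, star_mul', star_neg, hl]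
  simp only [div_eq_mul_inv, mul_inv]
  ring

/-- The Cauchy–Gram kernel of the branch is non-negative at two levels in the first gap: if every
node carrying weight is `0` or exceeds both `ε, ε' > 0` then `0 ≤ K(ε, ε')`. [folklore] -/
theorem rankOne_branch_kernel_nonneg {L : Matrix ι ι ℂ} (hH : L.IsHermitian) (s : ι → ℂ)
    {ε ε' : ℝ} (hε : 0 < ε) (hε' : 0 < ε')
    (hgap : ∀ j, star (hH.eigenvectorBasis j : ι → ℂ) ⬝ᵥ s ≠ 0 → hH.eigenvalues j ≠ 0 →
      ε < hH.eigenvalues j ∧ ε' < hH.eigenvalues j) :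
    0 ≤ ∑ j, ‖star (hH.eigenvectorBasis j : ι → ℂ) ⬝ᵥ s‖ ^ 2 /
        ((hH.eigenvalues j - ε) * (hH.eigenvalues j - ε')) := by
  refine cauchyGram_nonneg _ hH.eigenvalues (fun j => sq_nonneg _) fun j hj => ?_
  have ha : star (hH.eigenvectorBasis j : ι → ℂ) ⬝ᵥ s ≠ 0 := by
    intro h0; apply hj; rw [h0, norm_zero, zero_pow two_ne_zero]
  by_cases hl : hH.eigenvalues j = 0
  · rw [hl, zero_sub, zero_sub]; nlinarith
  · obtain ⟨h1, h2⟩ := hgap j ha hl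
    exact mul_pos (sub_pos.2 h1) (sub_pos.2 h2)

/-- `‖conj(c) c' K‖ = ‖c‖ ‖c'‖ K` for a real `K ≥ 0`. [folklore] -/
theorem norm_star_mul_mul_ofReal (c c' : ℂ) {K : ℝ} (hK : 0 ≤ K) :
    ‖star c * c' * (K : ℂ)‖ = ‖c‖ * ‖c'‖ * K := by
  rw [norm_mul, norm_mul, Complex.star_def, Complex.norm_conj, Complex.norm_real,
    Real.norm_of_nonneg hK]

omit [DecidableEq ι] in
/-- Cauchy–Schwarz for unit vectors in dot-product form: `|⟨φ, ψ⟩| ≤ 1`. [folklore] -/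
theorem norm_star_dotProduct_le_one {φ ψ : ι → ℂ} (hφ : star φ ⬝ᵥ φ = 1)
    (hψ : star ψ ⬝ᵥ ψ = 1) : ‖star φ ⬝ᵥ ψ‖ ≤ 1 := by
  have h1 : star φ ⬝ᵥ ψ = ⟪(WithLp.toLp 2 φ : EuclideanSpace ℂ ι), WithLp.toLp 2 ψ⟫_ℂ :=
    star_coe_dotProduct_eq_inner (WithLp.toLp 2 φ) ψ
  have hn : ∀ x : ι → ℂ, star x ⬝ᵥ x = 1 → ‖(WithLp.toLp 2 x : EuclideanSpace ℂ ι)‖ = 1 := by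
    intro x hx
    have h := inner_self_eq_norm_sq_to_K (𝕜 := ℂ) (WithLp.toLp 2 x : EuclideanSpace ℂ ι)
    rw [EuclideanSpace.inner_eq_star_dotProduct, dotProduct_comm] at h
    have h2 : star x ⬝ᵥ x = ((‖(WithLp.toLp 2 x : EuclideanSpace ℂ ι)‖ : ℝ) : ℂ) ^ 2 := h
    rw [hx, ← Complex.ofReal_pow] at h2
    have h3 : ‖(WithLp.toLp 2 x : EuclideanSpace ℂ ι)‖ ^ 2 = 1 := by exact_mod_cast h2.symm
    have h4 : 0 ≤ ‖(WithLp.toLp 2 x : EuclideanSpace ℂ ι)‖ := norm_nonneg _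
    nlinarith
  rw [h1]
  calc ‖⟪(WithLp.toLp 2 φ : EuclideanSpace ℂ ι), WithLp.toLp 2 ψ⟫_ℂ‖
      ≤ ‖(WithLp.toLp 2 φ : EuclideanSpace ℂ ι)‖ * ‖(WithLp.toLp 2 ψ : EuclideanSpace ℂ ι)‖ :=
        norm_inner_le_norm _ _
    _ = 1 := by rw [hn φ hφ, hn ψ hψ, one_mul]

end Summit.HubbardSuperconductivity.HubbardSuperconductivity.Theorems.AnisotropyChord
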